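import Literature.NumberTheory.EllipticCurves.ManinConstantQuadraticTwist
import Literature.NumberTheory.EllipticCurves.ManinConstantGamma1Gamma0Comparison
import Literature.NumberTheory.EllipticCurves.Isogeny
import Literature.NumberTheory.EllipticCurves.CongruenceNumber
import HarnessLib
import HarnessLib.Audit.Tags

/-!
# Candidates E-imc-25 / E-imc-26 / E-imc-30: what the SHIMURA-SUBGROUP HECKE CONGRUENCE leaves open —
# `OptimalIsMinimalOfTwoAdditivePrimes` (two additive primes ⇒ the optimal curve is the minimal curve),
# `PMulOptimalLatticeLeOfAdditivePrime` (one additive prime `p` ⇒ every Manin multiplier of the class divides `p`),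
# `Gamma1LatticeNeOfOddCongruenceNumber` (THEOREM S, lattice shadow: odd congruence number at `N = 4p` ⇒
# `Λ₁(f) ≠ Λ₀(f)`) — cell `bsd-f2-manin` (D-0131 (3) frontier: the Manin constant at additive primes).
# `@[conjecture]` leaf (NOTHING asserted; definitions only).

HONEST FRAMING. LENS = Iwasawa-main-conjecture / family-integrality read on the Shimura subgroup
`Σ(N) = ker(J₀(N) → J₁(N))` (planner-of-record `bsd-f2-manin-imc` g5, HOME `run/shared/lean/pub/bsd-f2-manin/MEMO-imc.md`
§13; Props VERBATIM from HOME/imc/Sketch-imc-g5.lean sha16 d8066faab1768902, namespace `BsdF2ManinImcG5`, farm rc 0 ·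
0 sorries · 0 warnings).  THE THEOREM BEHIND (now in the tree, PROVED:
`Literature/NumberTheory/EllipticCurves/ShimuraSubgroupHeckeCongruence.lean`): Ling–Oesterlé's «`T_p = p` on `Σ(N)`
for `p ∣ N`» in period-lattice form `HeckeEigenPeriodCongruence` (`(a_p − p)Λ₀(f) ⊆ Λ₁(f)`), whence two additive
primes ⇒ `Λ₁(f) = Λ₀(f)` (`E₁ = E₀`, `c₁ = c₀`) and one additive prime `p` ⇒ `p Λ₀ ⊆ Λ₁` (the Shimura cover
`E₁ → E₀` is killed by `p`).  With Stevens' conjecture `E₁ = E_*` (the minimal curve) this EXPLAINS the whole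
additive tier of Cremona's Manin table (`c_E / c₀ = n_ψ ∣ [L(E₀) : L(E_*)] = #(E₀ ∩ Σ)`); the two data laws below
are exactly that conjectural step, and THEOREM S is the cell's paper theorem deciding which `μ₂ ⊂ Σ(4p)` lie on
`E₀`.  BC5 WITNESS: HOME/imc/g5-shimura.py → g5-shimura.out 9bd618e5c5aec6ff, g5-shimura-gain.tsv (Cremona
`opt_man`, `N < 5·10⁵`; multi-curve classes with ≥ 2 additive primes 210 554, with exactly one 295 868, singles
1 498 017; gain classes 259 = 162 semistable + 94 (`p = 2`, `c = 2`) + 2 (`p = 3`, `c = 3`: 27a, 54a) + 1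
(390150gy, the certified mislabel E-imc-19); 0 violations of either law after that correction), independently
re-counted by refuter-1 (HOME/ref1/imc25.py → R19-imc25.out 8bacd89d91697874: «your numbers exactly»).  NOT IN
PRINT (refuter-2 g5, R-imc-12/15, ref2/LIT-PLACEMENT v6 §J⁶): E-imc-25/26 conjecture-level (= the tree corollaries
∘ Stevens II ∘ `c₀ = 1`; nearest Stevens 1989 Conj. II, Vatsal 2005 Conj. 1.9 / Thm 1.10; BK14 p. 2 «33825be»
an erratum candidate, not a counterexample); E-imc-30 NOT-IN-PRINT, prime-level companion IN PRINT
(Stein–Watkins 2004 Prop. 3.2 via Mazur's `Σ = U^∨`), parity template = Yazdani's printed open expectation.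
Refuter verdicts: REF1 **SURVIVES ×2** (E-imc-25/26: HOME/REFUTER-ref1.md §R19.1–3, 19:03Z; BC7 CLEAN;
read-back: `IsNeronLatticeOf` pins `L₂`, `Isogeny` non-constant ⇒ honest lattice statements «`c_E = c₀ ∀ E`» /
«`c_E / c₀ ∈ {1, p}`»; n19a: in CM classes the typed inclusion may be weaker) and **SURVIVES as THEOREM-candidate,
proof SOUND modulo (L1)/(L2)** (E-imc-30: §R21.3, 19:25Z; `congruenceNumber` = full-space `r_f`, junk 0 not odd;
root-count ⟺ `E(ℚ)[2] ≅ ℤ/2`); REF2 as above.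
-/

noncomputable section

open scoped MatrixGroups ModularForm

open CongruenceSubgroup WeierstrassCurve
  Literature.NumberTheory.EllipticCurves Literature.NumberTheory.EllipticCurves.ModularForms

namespace Summit.BirchSwinnertonDyer.Rank1Residual.ManinAdditive

/-- **Candidate E-imc-25 `OptimalIsMinimalOfTwoAdditivePrimes` (cell bsd-f2-manin, MEMO-imc §13; DATA LAW —
NOT in print, nothing asserted; proof route: tree `Gamma1LatticeEqOfTwoTracelessPrimes` ∘ Stevens' conjecture
`E₁ = E_*`):** if the globally minimal `W` has two distinct primes `p, q` with `p² ∣ N`, `q² ∣ N` (two ADDITIVE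
primes, `N = N(W)`) and is `X₀(N)`-optimal (lattice-optimal datum `D` at the conductor), then `W` is the MINIMAL
curve of its class: `Λ_W ⊆ Λ_{W₂}` for every globally minimal `W₂` isogenous to `W` (`_φ`, decorative) and every
Néron pair `L₂` of `W₂` (Stevens 1989 Thm 2.3).  BC5: Cremona `opt_man`, `N < 5·10⁵`: 210 554 / 210 554 multi-curve
classes with ≥ 2 additive primes have `c_E = 1` for every curve (`⟺ E₀ = E_*` given `c₀ = 1`), the unique
pre-correction exception 390150gy being the mislabel of E-imc-19; 1 498 017 single-curve classes trivially.  Why it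
might fail: a class with two additive primes where Stevens' conjecture fails (`E_* → E₁ = E₀` of degree > 1); none
below `5·10⁵`.
[cite: Stevens1989, Thm. 2.3 and Conj. II (shape only: the minimal curve and E₁ = E_*; the two-additive-primes law E₀ = E_* is NOT in print — cell bsd-f2-manin MEMO-imc.md §13, E-imc-25)]
[cite: Vatsal2005, Conj. 1.9 and Thm. 1.10] [cite: LingOesterle1991, Thm. «T_p = p on Σ(N) for p ∣ N» (via Yoo2017 §3.2)] -/
@[conjecture] def OptimalIsMinimalOfTwoAdditivePrimes : Prop :=
  ∀ (W : WeierstrassCurve ℚ) [W.IsElliptic] [W.IsGloballyMinimal] [NeZero (W.conductorNorm ℤ)]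
    (D : ModularParametrizationData W (W.conductorNorm ℤ)) (p q : ℕ), p.Prime → q.Prime → p ≠ q →
    p ^ 2 ∣ W.conductorNorm ℤ → q ^ 2 ∣ W.conductorNorm ℤ →
    (∀ z ∈ D.L.lattice, ∃ w ∈ periodLattice D.f, z = D.c * w) →
    ∀ (W₂ : WeierstrassCurve ℚ) [W₂.IsElliptic] [W₂.IsGloballyMinimal]
      (_φ : WeierstrassCurve.Isogeny W W₂) (L₂ : PeriodPair),
      IsNeronLatticeOf (W₂.baseChange ℂ) L₂ → ∀ z ∈ D.L.lattice, z ∈ L₂.lattice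

/-- **Candidate E-imc-26 `PMulOptimalLatticeLeOfAdditivePrime` (cell bsd-f2-manin, MEMO-imc §13; DATA LAW — NOT
in print, nothing asserted; proof route: tree `PMulLatticeLeGamma1OfTracelessPrime` ∘ Stevens' conjecture
`E₁ = E_*` ∘ `c₀ = 1`):** if `p² ∣ N(W)` (an additive prime) and `W` is `X₀(N)`-optimal (lattice-optimal datum at
the conductor), then `p Λ_W ⊆ Λ_{W₂}` for every globally minimal `W₂` isogenous to `W` (`_φ`, decorative) and
every Néron pair `L₂` of `W₂`: the period index `[L(E₀) : L(E_*)]` — hence every Manin multiplier `c_E / c₀` in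
the class — divides `p`.  BC5: of the 506 422 multi-curve classes with an additive prime (`N < 5·10⁵`), the classes
containing a curve with `c_E > 1` are exactly 96 (after the E-imc-19 correction), each with ONE additive prime
`p ∈ {2, 3}` and `max c_E = p` (94 × 2; 27a and 54a × 3); `0` at `p ≥ 5` (901 + 68 + 7 candidate classes with a
root `p`-isogeny).  Why it might fail: a class with a unique additive prime `p` whose Shimura cover is `[p]` up to
isomorphism (`Λ₁ = p Λ₀`, forcing `p ∣ c₀`) or where Stevens' conjecture fails; none below `5·10⁵`.
[cite: Stevens1989, Thm. 2.3 and Conj. II (shape only; the «Manin multipliers divide the additive prime» law is NOT in print — cell bsd-f2-manin MEMO-imc.md §13, E-imc-26)]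
[cite: Cremona2022ManinConstants, opt_man / manin.txt (the 96 gain classes)] [cite: LingOesterle1991, Thm. «T_p = p on Σ(N) for p ∣ N» (via Yoo2017 §3.2)] -/
@[conjecture] def PMulOptimalLatticeLeOfAdditivePrime : Prop :=
  ∀ (W : WeierstrassCurve ℚ) [W.IsElliptic] [W.IsGloballyMinimal] [NeZero (W.conductorNorm ℤ)]
    (D : ModularParametrizationData W (W.conductorNorm ℤ)) (p : ℕ), p.Prime →
    p ^ 2 ∣ W.conductorNorm ℤ → (∀ z ∈ D.L.lattice, ∃ w ∈ periodLattice D.f, z = D.c * w) →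
    ∀ (W₂ : WeierstrassCurve ℚ) [W₂.IsElliptic] [W₂.IsGloballyMinimal]
      (_φ : WeierstrassCurve.Isogeny W W₂) (L₂ : PeriodPair),
      IsNeronLatticeOf (W₂.baseChange ℂ) L₂ → ∀ z ∈ D.L.lattice, (p : ℂ) * z ∈ L₂.lattice

/-- **Candidate E-imc-30 `Gamma1LatticeNeOfOddCongruenceNumber` (cell bsd-f2-manin, MEMO-imc §13.9; THEOREM S in
lattice language — a paper theorem of the cell (proof in `J₀(4p)[2]`: `Σ[2]` rational, `m_E ∣ r_f` odd ⇒
`J₀(N)[2] = E₀[2] ⊕ A′[2]` Hecke-equivariantly, Ling–Oesterlé + `a₂ = 0` ⇒ the `A′`-component lies in `A′[𝔐_f]`,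
non-zero would make 2 a congruence prime; so the Shimura 2-torsion point is `T ∈ E₀`, and THEOREM W gives
`E₀ ∩ Σ = ⟨T⟩`), NOT yet a Lean target (the tree has `congruenceNumber` but not `J₀(N)[2]` as a Hecke–Galois
module); nothing asserted here).**  At level `N = 4p`, `p ≡ 1 (mod 4)` prime, for a newform `f = D.f` (`IsNewform0`)
whose `X₀(4p)`-lattice-optimal curve `W` has exactly one rational root of its 2-torsion cubic,
`Odd (congruenceNumber f)` forces `Λ₁(f) ≠ Λ₀(f)` (and then, by the tree's `PMulLatticeLeGamma1OfTracelessPrime`,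
`[Λ₀ : Λ₁] = 2`: the class GAINS, `E₁ = E₀/⟨T⟩` has `X₀`-Manin constant `2c₀` by Stevens' «`E₁ → E₀` étale»).
With Yazdani's Thm 3.8 (`r_f` odd, `N = 4p` ⇒ `p = m² + 4`, `E ~ E_m`) this REDUCES the `4p` branch of E-imc-27
(`FourPFamilyManinEven`, leaf `FourPFamilyManinLaws`) to the printed expectation «the `m² + 4` family has odd
congruence number».  BC5: the 55 family levels `4(m² + 4) < 5·10⁵` have `deg φ₀` odd (`r(20a1) = 1`); control 36a1
(`r = 1`, `#Σ(36) = 1` odd — hypothesis `N = 4p` fails, no gain ✓).  Why it might fail: only through the paper steps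
(L1) Hecke-support ⇔ congruence prime at a non-semisimple `𝕋 ⊗ 𝔽₂`, (L2) the decomposition `J[2] = E₀[2] ⊕ A′[2]`
uses `m_E` odd, implied by `r_f` odd via Ribet — both graded IN PRINT by refuter-2 (R-imc-15).
[cite: SteinWatkins2004, Prop. 3.2 (the PRIME-level companion via Mazur's Σ = U^∨; the N = 4p statement is NOT in print — cell bsd-f2-manin MEMO-imc.md §13.9, E-imc-30; ref2: beyond-print YES small, paper-level)]
[cite: Yazdani2009, §2 and Thm. 3.8] [cite: LingOesterle1991, Thm. «T_p = p on Σ(N)» (via Yoo2017 §3.2)] -/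
@[conjecture] def Gamma1LatticeNeOfOddCongruenceNumber : Prop :=
  ∀ (p : ℕ) [NeZero (4 * p)] (W : WeierstrassCurve ℚ) [W.IsElliptic]
    (D : ModularParametrizationData W (4 * p)), p.Prime → p % 4 = 1 → IsNewform0 D.f →
    (∀ z ∈ D.L.lattice, ∃ w ∈ periodLattice D.f, z = D.c * w) →
    (W.twoTorsionPolynomial.toPoly.roots.toFinset.card = 1) →
    Odd (congruenceNumber D.f) → periodLatticeGamma1 D.f ≠ periodLattice D.f

end Summit.BirchSwinnertonDyer.Rank1Residual.ManinAdditive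

end
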